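import Literature.NumberTheory.EllipticCurves.BinaryQuarticLocalSolubility
import HarnessLib

/-!
# Hensel lifting for `z² = f(x, y)`: a smooth point modulo `p` gives `ℚ_p`-solubility

Topic `Literature/NumberTheory/EllipticCurves`; continues `BinaryQuarticLocalSolubility.lean`
(M. Bhargava, A. Shankar, *Binary quartic forms having bounded invariants, and the boundedness of
the average rank of elliptic curves*, Ann. of Math. (2) 181 (2015) 191–242).

In the proof of the uniformity estimate (Prop. 5.13 of the held arXiv text `arXiv:1006.1002v2`,
Prop. 3.18 of the published version) Bhargava–Shankar use: *"if the splitting type of `f` at `p` is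
`(1²11)` or `(1³1)`, then the reduction of `f` modulo `p` has a single root in `ℙ¹(𝔽_p)`, which
lifts to a root in `ℙ¹(ℚ_p)` by Hensel's Lemma. Thus `f` is `ℚ_p`-soluble"*, and, for
`p ∤ Δ(f)`, that `f` is `ℚ_p`-soluble ("see [Cremona, *Algorithms*]": a smooth point of the
reduction of the genus-one curve `z² = f(x,y)` lifts). This file proves the two Hensel lifting
statements behind this, for a form `f` over `ℤ_p`:

* `isSoluble_of_simple_root` — if `t ∈ ℤ_p` is a simple root of `f(·,1)` modulo `p`
  (`p ∣ f(t,1)`, `p ∤ ∂f/∂x(t,1)`), then `f` has a zero in `ℙ¹(ℚ_p)`, so is `ℚ_p`-soluble;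
* `isSoluble_of_unit_square_value` — if `p ≠ 2` and `f(t,1) ≡ w² (mod p)` with `w` a unit, then
  `f(t,1)` is a square in `ℤ_p`, so `f` is `ℚ_p`-soluble;

i.e. **a smooth `𝔽_p`-point of (the affine chart `y = 1` of) `z² = f(x,y)` lifts to a
`ℤ_p`-point** (`isSoluble_of_smooth_point_mod_p`). (The remaining input of Prop. 3.18 — that for
`p ∤ Δ(f)` the reduction has a smooth `𝔽_p`-point at all, i.e. the Hasse–Weil bound in genus one —
is not addressed here.)

## References

* [BhargavaShankarAnnals2015] Prop. 5.13, proof (arXiv v2 numbering) = Prop. 3.18 (published).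
  [cite: BhargavaShankarAnnals2015, Prop. 5.13, proof (arXiv:1006.1002v2 numbering)]
* Hensel's lemma as in Mathlib (`hensels_lemma`).
-/

noncomputable section

open scoped Classical
open Polynomial

namespace Literature.NumberTheory.EllipticCurves

namespace BinaryQuartic

variable {p : ℕ} [Fact p.Prime]

/-- **A simple root modulo `p` lifts** (Hensel): if `‖f(t,1)‖ < 1` and `‖∂f/∂x(t,1)‖ = 1` for
some `t ∈ ℤ_p`, then `f(t',1) = 0` for some `t' ∈ ℤ_p`. [folklore] -/
theorem exists_eval_eq_zero_of_simple_root (f : BinaryQuartic ℤ_[p]) {t : ℤ_[p]}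
    (h0 : ‖f.eval t 1‖ < 1) (h1 : ‖4 * f.a * t ^ 3 + 3 * f.b * t ^ 2 + 2 * f.c * t + f.d‖ = 1) :
    ∃ t' : ℤ_[p], f.eval t' 1 = 0 := by
  have hF : f.toPoly.eval t = f.eval t 1 := by
    simp only [toPoly, eval, Polynomial.eval_add, Polynomial.eval_mul, Polynomial.eval_C,
      Polynomial.eval_pow, Polynomial.eval_X]
    ring
  have hnorm : ‖f.toPoly.aeval t‖ < ‖f.toPoly.derivative.aeval t‖ ^ 2 := by
    simp only [Polynomial.coe_aeval_eq_eval]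
    rw [eval_derivative_toPoly, h1, hF, one_pow]
    exact h0
  obtain ⟨t', ht', -⟩ := hensels_lemma hnorm
  refine ⟨t', ?_⟩
  have : f.toPoly.eval t' = 0 := by simpa [Polynomial.coe_aeval_eq_eval] using ht'
  simp only [toPoly, Polynomial.eval_add, Polynomial.eval_mul, Polynomial.eval_C,
    Polynomial.eval_pow, Polynomial.eval_X] at this
  simp only [eval]
  linear_combination this

/-- **`ℚ_p`-solubility from a simple root modulo `p`** (Bhargava–Shankar, proof of Prop. 5.13:
"a single root in `ℙ¹(𝔽_p)` … lifts to a root in `ℙ¹(ℚ_p)` by Hensel's Lemma. Thus `f` is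
`ℚ_p`-soluble"): if `p ∣ f(t,1)` and `p ∤ ∂f/∂x(t,1)` (as elements of `ℤ_p`) then `f` is
`ℚ_p`-soluble. [cite: BhargavaShankarAnnals2015, Prop. 5.13, proof (arXiv:1006.1002v2 numbering)] -/
theorem isSoluble_of_simple_root (f : BinaryQuartic ℤ_[p]) {t : ℤ_[p]}
    (h0 : (p : ℤ_[p]) ∣ f.eval t 1) (h1 : ¬ (p : ℤ_[p]) ∣ 4 * f.a * t ^ 3 + 3 * f.b * t ^ 2 + 2 * f.c * t + f.d) :
    (f.map PadicInt.Coe.ringHom).IsSoluble := by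
  have h0' : ‖f.eval t 1‖ < 1 := by
    obtain ⟨c, hc⟩ := h0
    rw [hc, norm_mul, PadicInt.norm_p]
    calc (p : ℝ)⁻¹ * ‖c‖ ≤ (p : ℝ)⁻¹ * 1 := by gcongr; exact PadicInt.norm_le_one c
      _ < 1 := by
        rw [mul_one, inv_lt_one_iff₀]
        exact Or.inr (by exact_mod_cast (Fact.out : p.Prime).one_lt)
  have h1' : ‖4 * f.a * t ^ 3 + 3 * f.b * t ^ 2 + 2 * f.c * t + f.d‖ = 1 := by
    rcases (PadicInt.norm_le_one (4 * f.a * t ^ 3 + 3 * f.b * t ^ 2 + 2 * f.c * t + f.d)).lt_or_eq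
      with h | h
    · exact absurd ((PadicInt.norm_lt_one_iff_dvd _).mp h) h1
    · exact h
  obtain ⟨t', ht'⟩ := exists_eval_eq_zero_of_simple_root f h0' h1'
  exact isSoluble_map_coe_of_eval_eq_sq f (Or.inr one_ne_zero) (z := 0) (by rw [ht']; ring)

/-- **A unit square modulo an odd prime lifts** (Hensel): if `p ≠ 2`, `w` is a unit of `ℤ_p` and
`‖c − w²‖ < 1`, then `c` is a square in `ℤ_p`. [folklore] -/
theorem exists_sq_eq_of_unit (hp : p ≠ 2) {w c : ℤ_[p]} (hw : ‖w‖ = 1) (h : ‖c - w ^ 2‖ < 1) :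
    ∃ z : ℤ_[p], z ^ 2 = c := by
  refine exists_sq_eq_of_norm_sub_lt (z := w) ?_
  have h2 : ‖(2 : ℤ_[p])‖ = 1 := by
    rw [show (2 : ℤ_[p]) = ((2 : ℕ) : ℤ_[p]) by norm_num, PadicInt.norm_natCast_eq_one_iff]
    exact (Nat.coprime_primes (Fact.out : p.Prime) Nat.prime_two).mpr hp
  rw [norm_mul, h2, hw, one_mul, one_pow, norm_sub_rev]
  exact h

/-- **`ℚ_p`-solubility from a unit square value modulo an odd `p`**: if `p ≠ 2` and
`f(t,1) ≡ w² (mod p)` with `w ∈ ℤ_pˣ`, then `f(t,1)` is a square in `ℤ_p` and `f` is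
`ℚ_p`-soluble. [folklore] -/
theorem isSoluble_of_unit_square_value (hp : p ≠ 2) (f : BinaryQuartic ℤ_[p]) {t w : ℤ_[p]}
    (hw : ¬ (p : ℤ_[p]) ∣ w) (h : (p : ℤ_[p]) ∣ f.eval t 1 - w ^ 2) :
    (f.map PadicInt.Coe.ringHom).IsSoluble := by
  have hw' : ‖w‖ = 1 := by
    rcases (PadicInt.norm_le_one w).lt_or_eq with h' | h'
    · exact absurd ((PadicInt.norm_lt_one_iff_dvd w).mp h') hw
    · exact h'
  have h' : ‖f.eval t 1 - w ^ 2‖ < 1 := (PadicInt.norm_lt_one_iff_dvd _).mpr h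
  obtain ⟨z, hz⟩ := exists_sq_eq_of_unit hp hw' h'
  exact isSoluble_map_coe_of_eval_eq_sq f (Or.inr one_ne_zero) hz

/-- **A smooth `𝔽_p`-point of `z² = f(x, 1)` lifts to a `ℤ_p`-point** (`p` odd): if
`w² ≡ f(t,1) (mod p)` and the point `(t, w)` of the reduction is smooth — `p ∤ w` (then
`2w ≢ 0`), or `p ∣ w` and `p ∤ ∂f/∂x(t,1)` — then `f` is `ℚ_p`-soluble. This is the Hensel step
in the proof that forms with `p ∤ Δ` (more generally, of splitting type `(1²11)`, `(1³1)` at `p`)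
are `ℚ_p`-soluble (Bhargava–Shankar, proof of Prop. 5.13).
[cite: BhargavaShankarAnnals2015, Prop. 5.13, proof (arXiv:1006.1002v2 numbering)] -/
theorem isSoluble_of_smooth_point_mod_p (hp : p ≠ 2) (f : BinaryQuartic ℤ_[p]) {t w : ℤ_[p]}
    (h : (p : ℤ_[p]) ∣ f.eval t 1 - w ^ 2)
    (hsmooth : ¬ (p : ℤ_[p]) ∣ w ∨ ¬ (p : ℤ_[p]) ∣ 4 * f.a * t ^ 3 + 3 * f.b * t ^ 2 + 2 * f.c * t + f.d) :
    (f.map PadicInt.Coe.ringHom).IsSoluble := by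
  by_cases hw : (p : ℤ_[p]) ∣ w
  · have h1 : ¬ (p : ℤ_[p]) ∣ 4 * f.a * t ^ 3 + 3 * f.b * t ^ 2 + 2 * f.c * t + f.d :=
      hsmooth.resolve_left (not_not.mpr hw)
    refine isSoluble_of_simple_root f ?_ h1
    have : (p : ℤ_[p]) ∣ w ^ 2 := dvd_pow hw two_ne_zero
    simpa using dvd_add h this
  · exact isSoluble_of_unit_square_value hp f hw h

end BinaryQuartic

end Literature.NumberTheory.EllipticCurves

end
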